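/-
Copyright: seat `ym-line-fcl-p3` g36 (prover-ym-line-fcl-p3-g36-0), free hands on LINE-18 v5 of crux `AllWindowsColdBox.BulkMidWindowSU2`
(stmt-QuantumFields-24006), obligation R `KernelLargeFieldRarityFlatG` (half 2 of the registered stub `stub_potentialCorollaries`).
-/
import Summits.QuantumFields.YangMills.Theorems.AllWindowsColdBoxYmSpecificationReferenceBound
import Summits.QuantumFields.YangMills.Theorems.ColdBoxAllGroupsBulkAllGroupsKernelGoodEventG
import Summits.QuantumFields.YangMills.Theorems.LocalInsertionTorusHyperplaneTwist

/-!
# Large fields inside the cold box are rare UNIFORMLY over crude-good data at the FLAT rate `ε > 2θ + δ` — any compact gauge group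
# (obligation R `KernelLargeFieldRarityFlatG` of LINE-18 v5 on crux `BulkMidWindowSU2`, stmt-QuantumFields-24006; supersedes brick B5-G's `ε > 3θ + δ`)

WHAT.  For a compact `G` with a continuous unitary representation `ρ` of degree `N ≥ 1`, `0 < θ`, `0 ≤ δ` and **`ε > 2θ + δ`**: for all large `β`
and EVERY datum `ω` with `CrudeGoodG ρ β δ ⌈β^θ⌉ ω`, the box kernel `γ_Λ(·|ω) = boxKernelG ρ β H ω` (`Λ = boxEdges 4 (2H+1)`, `H = ⌈β^θ⌉`) gives
the large-field event «some plaquette touching `Λ` costs `≥ β^{2ε−1}`» mass `≤ exp(−β^ε)`: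
* `exists_boxKernelG_largeField_le_crudeGood_flat` — explicit form `γ_Λ(LF ≥ s | ω) ≤ e^{−βs} · e^{(2Nβ^{2δ} + 16N)·#Λ'} · (c(√β)^D)^{#Λ}`
  (`Λ'` = plaquettes touching `Λ`, `D = dim_ℝ 𝔤(ρ(G))`), every `H`, every `β ≥ 1`;
* `boxKernelG_largeField_rarity_crudeGood_flat`, `boxKernelG_real_coldGoodSetG_compl_le_flat` — the one-scale forms (`ε > 2θ + δ`).
The tree's B5-G `boxKernelG_largeField_rarity_crudeGood` needs `ε > 3θ + δ`: it takes the IDENTITY as reference configuration after the comb gauge of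
B4-G, where a crude-good datum has link radius `a = 4(2H+3)√(2β^{2δ−1})`, i.e. energy `≍ H²β^{2δ}` per plaquette.

WHY THE FLAT RATE IS FREE.  `CrudeGoodG ρ β δ H ω` bounds the cost of EVERY plaquette of `ω` based in the corona range `[−1, 2H+1]⁴` — in particular of
every plaquette touching `Λ`, interior ones included (`base_mem_range_of_mem_plaquettesTouching_boxEdges`).  So in the Laplace lower bound of the
normaliser `Z_Λ(ω)` the reference configuration can be the datum's OWN restriction `ω|_Λ` (tree `ymSpecification_reference_real_le`, the reference Gibbs
bound with an arbitrary reference `V`): on the product Haar ball of radius `r = β^{−1/2}` around `ω|_Λ` every plaquette holonomy is within `4r` of `ω`'s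
(`norm_plaquetteHolonomyZd_sub_le_of_near`, operator norm), hence costs `≤ N((4r + ‖ρ(ω_p) − 1‖)²)/2 ≤ 2N·cost_p(ω) + 16Nr² ≤ 2Nβ^{2δ−1} + 16N/β`
(`plaqCost_glueWith_le_of_near`; the tree's `half_sq_le_actionTerm` / `actionTerm_le_of_norm_le`).  Total `βM ≤ #Λ'(2Nβ^{2δ} + 16N) ≍ β^{4θ+2δ}`;
with `Haar(ball_r)^{#Λ} ≥ (c β^{−D/2})^{#Λ}` the exponent is `−β^{2ε} + O(β^{4θ+2δ}) + O(β^{4θ} log β) ≤ −β^ε` once `2ε > 4θ + 2δ`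
(`eventually_neg_rpow_add_le` at `θ' = (2θ+δ)/2`).  No gauge fixing, no harmonic extension, no Lie-algebra chart.

HONEST LABEL: a G-generic one-scale small-field estimate (helper toward ONE half of a registered bundle stub of a critic-passed DRAFT line on the R2ξ″
RECORD-rung crux 24006); no crux, rung or summit is closed by this file; the Yang–Mills mass gap is NOT proved by any of this.

References: T. Bałaban, CMP 109 (1987) (0.14)–(0.15) p. 254; S. Chatterjee, arXiv:1602.01222 §9 (Laplace lower bound on `Z`).
-/

set_option autoImplicit false

noncomputable section

open MeasureTheory Finset
open scoped Matrix.Norms.L2Operator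
open Literature.Probability.LatticeModels (glueWith glueWith_apply_mem glueWith_apply_not_mem)
open Literature.MathematicalPhysics Literature.MathematicalPhysics.QuantumLattice
open Literature.MathematicalPhysics.QuantumFieldTheory
open Literature.MathematicalPhysics.QuantumFieldTheory.PlaquetteTail (actionTerm_le_of_norm_le half_sq_le_actionTerm)
open Literature.MathematicalPhysics.QuantumFieldTheory.Balaban1983to89.HaarSmallBallClosedSubgroup (haarReal_ball_ge_of_unitaryRep)
open Summit.QuantumFields.YangMills.Theorems.WeakCouplingRates
open Summit.QuantumFields.YangMills.Theorems.LocalInsertion.TorusTwist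
  (norm_rep_le_one norm_rep_inv_sub_rep_inv norm_mul_sub_mul_le_of_norm_le_one)

namespace Summit.QuantumFields.YangMills.Theorems.ColdBoxAllGroups

/-! ### §1. Every plaquette touching the box is based in the corona range -/

/-- The base point of a plaquette touching `Λ = boxEdges 4 (2H+1)` (vertex box `{0,…,2H}⁴`) lies in `[−1, 2H]⁴`, inside the corona range
`[−1, 2H+1]⁴` of `CrudeGoodG`. -/
theorem base_mem_range_of_mem_plaquettesTouching_boxEdges {H : ℕ} {q : ZdPlaquette 4}
    (hq : q ∈ plaquettesTouching (AxialGauge.boxEdges 4 (2 * H + 1))) (k : Fin 4) :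
    (-1 : ℤ) ≤ q.1 k ∧ q.1 k ≤ 2 * (H : ℤ) + 1 := by
  obtain ⟨e', he'⟩ := mem_plaquettesTouching_iff.1 hq
  rw [Finset.mem_inter] at he'
  obtain ⟨x', i'⟩ := e'
  have hΛ := (AxialGauge.mem_boxEdges_iff.1 he'.2).1 k
  have hq' := coord_of_mem_plaquetteEdges he'.1 k
  simp only at hq'
  push_cast at hΛ
  constructor <;> omega

/-! ### §2. Near configurations: plaquette holonomies and costs (operator norm along `ρ`) -/

section Near

variable {N : ℕ} [NeZero N] {G : Type*} [Group G]
variable (ρ : G →* Matrix (Fin N) (Fin N) ℂ) (hρu : ∀ g, ρ g ∈ Matrix.unitaryGroup (Fin N) ℂ)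

include hρu in
/-- **Near links give near plaquette variables** on `ℤ^d`: if `‖ρ(U_e) − ρ(V_e)‖ ≤ r` on every edge then `‖ρ(U_p) − ρ(V_p)‖ ≤ 4r` for every
plaquette (`ℤ^d` twin of `TorusTwist.norm_plaquetteHolonomy_sub_le`). -/
theorem norm_plaquetteHolonomyZd_sub_le_of_near {d : ℕ} {r : ℝ} {U V : LGConfig d G}
    (hUV : ∀ e, ‖ρ (U e) - ρ (V e)‖ ≤ r) (x : Literature.Probability.LatticeModels.Site d) (i j : Fin d) :
    ‖ρ (plaquetteHolonomyZd U x i j) - ρ (plaquetteHolonomyZd V x i j)‖ ≤ 4 * r := by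
  have h1 := norm_rep_le_one ρ hρu
  unfold plaquetteHolonomyZd
  simp only [map_mul]
  have hprod : ∀ g h : G, ‖ρ g * ρ h‖ ≤ 1 := fun g h => by rw [← map_mul]; exact h1 _
  have hprod3 : ∀ g h k : G, ‖ρ g * ρ h * ρ k‖ ≤ 1 := fun g h k => by rw [← map_mul, ← map_mul]; exact h1 _
  calc ‖ρ (U (x, i)) * ρ (U (x + Pi.single i 1, j)) * ρ (U (x + Pi.single j 1, i))⁻¹ * ρ (U (x, j))⁻¹ -
        ρ (V (x, i)) * ρ (V (x + Pi.single i 1, j)) * ρ (V (x + Pi.single j 1, i))⁻¹ * ρ (V (x, j))⁻¹‖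
      ≤ ‖ρ (U (x, i)) * ρ (U (x + Pi.single i 1, j)) * ρ (U (x + Pi.single j 1, i))⁻¹ -
          ρ (V (x, i)) * ρ (V (x + Pi.single i 1, j)) * ρ (V (x + Pi.single j 1, i))⁻¹‖ +
          ‖ρ (U (x, j))⁻¹ - ρ (V (x, j))⁻¹‖ :=
        norm_mul_sub_mul_le_of_norm_le_one (hprod3 _ _ _) (h1 _)
    _ ≤ ‖ρ (U (x, i)) * ρ (U (x + Pi.single i 1, j)) - ρ (V (x, i)) * ρ (V (x + Pi.single i 1, j))‖ +
          ‖ρ (U (x + Pi.single j 1, i))⁻¹ - ρ (V (x + Pi.single j 1, i))⁻¹‖ + ‖ρ (U (x, j))⁻¹ - ρ (V (x, j))⁻¹‖ := by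
        gcongr; exact norm_mul_sub_mul_le_of_norm_le_one (hprod _ _) (h1 _)
    _ ≤ ‖ρ (U (x, i)) - ρ (V (x, i))‖ + ‖ρ (U (x + Pi.single i 1, j)) - ρ (V (x + Pi.single i 1, j))‖ +
          ‖ρ (U (x + Pi.single j 1, i))⁻¹ - ρ (V (x + Pi.single j 1, i))⁻¹‖ + ‖ρ (U (x, j))⁻¹ - ρ (V (x, j))⁻¹‖ := by
        gcongr; exact norm_mul_sub_mul_le_of_norm_le_one (h1 _) (h1 _)
    _ ≤ r + r + r + r := by
        rw [norm_rep_inv_sub_rep_inv ρ hρu, norm_rep_inv_sub_rep_inv ρ hρu]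
        gcongr <;> exact hUV _
    _ = 4 * r := by ring

include hρu in
/-- **Near configurations have near plaquette costs**: if `‖ρ(U_e) − ρ(V_e)‖ ≤ r` on every edge then, for every plaquette,
`N − Re tr ρ(U_p) ≤ 2N·(N − Re tr ρ(V_p)) + 16N r²` (`N − Re tr ρ W ≤ N‖ρW − 1‖²/2`, `‖ρ(U_p) − 1‖ ≤ 4r + ‖ρ(V_p) − 1‖`,
`‖ρ(V_p) − 1‖²/2 ≤ N − Re tr ρ(V_p)`). -/
theorem plaqCostAt_le_of_near {d : ℕ} {r : ℝ} {U V : LGConfig d G}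
    (hUV : ∀ e, ‖ρ (U e) - ρ (V e)‖ ≤ r) (x : Literature.Probability.LatticeModels.Site d) (i j : Fin d) :
    plaqCostAt ρ x i j U ≤ 2 * N * plaqCostAt ρ x i j V + 16 * N * r ^ 2 := by
  unfold plaqCostAt plaquetteObs
  set t : ℝ := ‖ρ (plaquetteHolonomyZd V x i j) - 1‖ with ht
  have ht0 : 0 ≤ t := norm_nonneg _
  have hnear := norm_plaquetteHolonomyZd_sub_le_of_near ρ hρu hUV x i j
  have hU1 : ‖ρ (plaquetteHolonomyZd U x i j) - 1‖ ≤ 4 * r + t := by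
    calc ‖ρ (plaquetteHolonomyZd U x i j) - 1‖
        = ‖(ρ (plaquetteHolonomyZd U x i j) - ρ (plaquetteHolonomyZd V x i j)) +
            (ρ (plaquetteHolonomyZd V x i j) - 1)‖ := by rw [sub_add_sub_cancel]
      _ ≤ _ := (norm_add_le _ _).trans (add_le_add hnear le_rfl)
  have hup := actionTerm_le_of_norm_le ρ hρu hU1
  have hlow := half_sq_le_actionTerm ρ hρu ht0 (le_refl t)
  have hm : (0 : ℝ) ≤ N := Nat.cast_nonneg N
  have hsq : (4 * r + t) ^ 2 ≤ 2 * ((4 * r) ^ 2 + t ^ 2) := by nlinarith [sq_nonneg (4 * r - t)]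
  nlinarith [mul_le_mul_of_nonneg_left hsq hm, mul_le_mul_of_nonneg_left hlow hm]

omit [NeZero N] in
/-- The glued configuration of a ball around the datum's own restriction stays within `r` of the datum on EVERY edge. -/
theorem norm_glueWith_sub_le_of_ball {d : ℕ} {r : ℝ} (hr : 0 ≤ r) {Λ : Finset (QuantumLattice.ZdEdge d)} (ω : LGConfig d G)
    {ζ : ↥Λ → G} (hζ : ∀ e : ↥Λ, ‖ρ (ζ e) - ρ (ω e.1)‖ ≤ r) (e : QuantumLattice.ZdEdge d) :
    ‖ρ (glueWith Λ ζ ω e) - ρ (ω e)‖ ≤ r := by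
  by_cases he : e ∈ Λ
  · rw [glueWith_apply_mem _ _ _ he]; exact hζ ⟨e, he⟩
  · rw [glueWith_apply_not_mem _ _ _ he, sub_self, norm_zero]; exact hr

include hρu in
/-- **The boundary Wilson action on the reference ball around a crude-good datum**: if every plaquette of `ω` based in the corona range
`[−1, 2H+1]⁴` costs `≤ t` (`CrudeGoodG`) and `ζ` is within `r` of `ω|_Λ` on every edge of `Λ = boxEdges 4 (2H+1)`, then
`S_Λ(ζ ∨ ω) ≤ #Λ' · (2N t + 16N r²)`. -/
theorem wilsonBoundaryAction_glueWith_le_of_crudeGoodG {H : ℕ} {β δ r : ℝ} (hr : 0 ≤ r) {ω : LGConfig 4 G}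
    (hω : CrudeGoodG ρ β δ H ω) {ζ : ↥(AxialGauge.boxEdges 4 (2 * H + 1)) → G}
    (hζ : ∀ e : ↥(AxialGauge.boxEdges 4 (2 * H + 1)), ‖ρ (ζ e) - ρ (ω e.1)‖ ≤ r) :
    wilsonBoundaryAction ρ (AxialGauge.boxEdges 4 (2 * H + 1)) (glueWith (AxialGauge.boxEdges 4 (2 * H + 1)) ζ ω) ≤
      #(plaquettesTouching (AxialGauge.boxEdges 4 (2 * H + 1))) * (2 * N * β ^ (2 * δ - 1) + 16 * N * r ^ 2) := by
  unfold wilsonBoundaryAction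
  have hnear := norm_glueWith_sub_le_of_ball ρ hr ω hζ
  calc ∑ p ∈ plaquettesTouching (AxialGauge.boxEdges 4 (2 * H + 1)),
        ((N : ℝ) - plaquetteObs ρ p.1 p.2.1.1 p.2.1.2 (glueWith (AxialGauge.boxEdges 4 (2 * H + 1)) ζ ω))
      ≤ ∑ _p ∈ plaquettesTouching (AxialGauge.boxEdges 4 (2 * H + 1)), (2 * N * β ^ (2 * δ - 1) + 16 * N * r ^ 2) :=
        Finset.sum_le_sum fun q hq => by
          have h1 := plaqCostAt_le_of_near ρ hρu hnear q.1 q.2.1.1 q.2.1.2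
          have h2 : plaqCostAt ρ q.1 q.2.1.1 q.2.1.2 ω ≤ β ^ (2 * δ - 1) :=
            hω q.1 (base_mem_range_of_mem_plaquettesTouching_boxEdges hq) q.2.1.1 q.2.1.2 q.2.2
          have hm : (0 : ℝ) ≤ 2 * N := by positivity
          unfold plaqCostAt at h1 h2
          nlinarith [mul_le_mul_of_nonneg_left h2 hm]
    _ = _ := by rw [Finset.sum_const, nsmul_eq_mul]

end Near

/-! ### §3. Large fields are rare in the box, uniformly over crude-good data, at the flat rate -/

variable {N : ℕ} [NeZero N] {G : Type*} [Group G] [TopologicalSpace G] [IsTopologicalGroup G] [CompactSpace G]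
  [MeasurableSpace G] [BorelSpace G] [SecondCountableTopology G]
variable (ρ : G →* Matrix (Fin N) (Fin N) ℂ) (hρu : ∀ g, ρ g ∈ Matrix.unitaryGroup (Fin N) ℂ) (hρc : Continuous ρ)

include hρu hρc in
/-- **The Gibbs large-field bound in the box with a crude-good datum, FLAT form** (any compact `G`, unitary `ρ` of degree `N ≥ 1`,
`D = dim_ℝ 𝔤(ρ(G))`).  There is `c > 0` such that for every `H`, every `β ≥ 1`, every `δ`, every crude-good `ω` and every `s`:
`γ_Λ({∃ p touching Λ : cost_p ≥ s} | ω) ≤ e^{−βs} · e^{(2Nβ^{2δ} + 16N) · #Λ'} · (c (√β)^D)^{#Λ}`, `Λ = boxEdges 4 (2H+1)` — the Laplace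
lower bound on `Z_Λ(ω)` over the Haar ball of radius `β^{−1/2}` around the datum's own restriction `ω|_Λ`. -/
theorem exists_boxKernelG_largeField_le_crudeGood_flat :
    ∃ c : ℝ, 0 < c ∧ ∀ (H : ℕ) (β δ : ℝ), 1 ≤ β → ∀ ω : LGConfig 4 G,
      CrudeGoodG ρ β δ H ω → ∀ s : ℝ,
        (boxKernelG ρ β H ω).real
            {U | ∃ p ∈ plaquettesTouching (AxialGauge.boxEdges 4 (2 * H + 1)),
              s ≤ (N : ℝ) - plaquetteObs ρ p.1 p.2.1.1 p.2.1.2 U} ≤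
          Real.exp (-(β * s)) *
            Real.exp ((2 * N * β ^ (2 * δ) + 16 * N) * #(plaquettesTouching (AxialGauge.boxEdges 4 (2 * H + 1)))) *
            (c * Real.sqrt β ^ Module.finrank ℝ (matrixLieAlgebra (Set.range ρ))) ^ #(AxialGauge.boxEdges 4 (2 * H + 1)) := by
  obtain ⟨c, hc, -, hball⟩ := haarReal_ball_ge_of_unitaryRep ρ hρc hρu (R := 1) one_pos
  refine ⟨c⁻¹, by positivity, ?_⟩
  intro H β δ hβ ω hω s
  set D : ℕ := Module.finrank ℝ (matrixLieAlgebra (Set.range ρ)) with hD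
  set Λ := AxialGauge.boxEdges 4 (2 * H + 1) with hΛ
  have hβ0 : 0 < β := one_pos.trans_le hβ
  set E : Set (LGConfig 4 G) :=
    {U | ∃ p ∈ plaquettesTouching Λ, s ≤ (N : ℝ) - plaquetteObs ρ p.1 p.2.1.1 p.2.1.2 U} with hE
  have hEm : MeasurableSet E := measurableSet_exists_plaqCost_ge_of_rep ρ hρc Λ s
  -- the Haar ball of radius `β^{-1/2}`
  set q : ℝ := Real.sqrt β with hq
  have hq1 : 1 ≤ q := by rw [hq]; exact Real.one_le_sqrt.2 hβ
  have hq0 : 0 < q := one_pos.trans_le hq1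
  set r₀ : ℝ := q⁻¹ with hr₀
  have hr0 : 0 < r₀ := inv_pos.2 hq0
  have hr1 : r₀ ≤ 1 := inv_le_one_of_one_le₀ hq1
  haveI : (haarProbability G).IsMulLeftInvariant := by
    unfold haarProbability; infer_instance
  have hb : c * r₀ ^ D ≤ (haarProbability G).real {g | ‖ρ g - 1‖ ≤ r₀} := hball (haarProbability G) r₀ hr0 hr1
  have hcb : 0 < c * r₀ ^ D := by positivity
  have hs : ∀ U ∈ E, s ≤ wilsonBoundaryAction ρ Λ U := fun U hU =>
    le_wilsonBoundaryAction_of_exists_plaqCost_ge_of_rep ρ hρu hU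
  -- the reference Gibbs bound around `V = ω|_Λ`
  have key := ymSpecification_reference_real_le ρ hρu hρc hβ0.le Λ hEm hs hcb hb ω (fun e : ↥Λ => ω e.1)
    (M := #(plaquettesTouching Λ) * (2 * N * β ^ (2 * δ - 1) + 16 * N * r₀ ^ 2))
    (fun ζ hζ => wilsonBoundaryAction_glueWith_le_of_crudeGoodG ρ hρu hr0.le hω hζ)
  unfold boxKernelG
  refine key.trans (le_of_eq ?_)
  -- bookkeeping
  have hβt : β * β ^ (2 * δ - 1) = β ^ (2 * δ) := by
    rw [show β * β ^ (2 * δ - 1) = β ^ (1 : ℝ) * β ^ (2 * δ - 1) by rw [Real.rpow_one], ← Real.rpow_add hβ0]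
    congr 1; ring
  have hβr : β * r₀ ^ 2 = 1 := by
    rw [hr₀, hq, inv_pow, Real.sq_sqrt hβ0.le, mul_inv_cancel₀ hβ0.ne']
  have e1 : β * (#(plaquettesTouching Λ) * (2 * N * β ^ (2 * δ - 1) + 16 * N * r₀ ^ 2)) =
      (2 * N * β ^ (2 * δ) + 16 * N) * #(plaquettesTouching Λ) := by
    have : β * (#(plaquettesTouching Λ) * (2 * N * β ^ (2 * δ - 1) + 16 * N * r₀ ^ 2)) =
        (2 * N * (β * β ^ (2 * δ - 1)) + 16 * N * (β * r₀ ^ 2)) * #(plaquettesTouching Λ) := by ring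
    rw [this, hβt, hβr, mul_one]
  have e2 : (c * r₀ ^ D)⁻¹ = c⁻¹ * q ^ D := by
    rw [hr₀, inv_pow, mul_inv, inv_inv]
  rw [e1, div_eq_mul_inv, ← inv_pow, e2]

include hρu hρc in
/-- **Large fields are rare in the box, UNIFORMLY over crude-good data, at the FLAT rate** (any compact `G`, unitary `ρ` of degree `N ≥ 1`).
For `0 < θ`, `0 ≤ δ` and **`ε > 2θ + δ`**: for all large `β` and every datum `ω` with `CrudeGoodG ρ β δ ⌈β^θ⌉ ω`, the box kernel
`γ_Λ(·|ω) = boxKernelG ρ β ⌈β^θ⌉ ω` (`Λ = boxEdges 4 (2⌈β^θ⌉+1)`) gives the event «some plaquette touching the box costs at least `β^{2ε−1}`»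
probability at most `exp(−β^ε)` — the same window as the flat datum (`boxState_largeField_rarity_of_rep`, `ε > 2θ`) up to the datum scale `δ`. -/
theorem boxKernelG_largeField_rarity_crudeGood_flat {θ δ ε : ℝ} (hθ : 0 < θ) (hδ : 0 ≤ δ) (hε : 2 * θ + δ < ε) :
    ∃ β₀ : ℝ, ∀ β : ℝ, β₀ ≤ β → ∀ ω : LGConfig 4 G, CrudeGoodG ρ β δ ⌈β ^ θ⌉₊ ω →
      (boxKernelG ρ β ⌈β ^ θ⌉₊ ω).real
          {U | ∃ p ∈ plaquettesTouching (AxialGauge.boxEdges 4 (2 * ⌈β ^ θ⌉₊ + 1)),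
            β ^ (2 * ε - 1) ≤ (N : ℝ) - plaquetteObs ρ p.1 p.2.1.1 p.2.1.2 U} ≤
        Real.exp (-(β ^ ε)) := by
  obtain ⟨c, hc, hmain⟩ := exists_boxKernelG_largeField_le_crudeGood_flat ρ hρu hρc
  set D : ℕ := Module.finrank ℝ (matrixLieAlgebra (Set.range ρ)) with hD
  -- θ' := (2θ + δ)/2: 4θ' = 4θ + 2δ, 2θ' = 2θ + δ < ε
  have hθ' : 0 < (2 * θ + δ) / 2 := by linarith
  have hε' : 2 * ((2 * θ + δ) / 2) < ε := by linarith
  obtain ⟨β₀, hβ₀1, hasy⟩ := eventually_neg_rpow_add_le hθ' hε'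
    (18 * N * 75000 + 2500 * |Real.log c|) (2500 * (D / 2)) (by positivity) (by positivity)
  refine ⟨β₀, fun β hβ ω hω => ?_⟩
  have hβ1 : 1 ≤ β := hβ₀1.trans hβ
  have hβ0 : 0 < β := one_pos.trans_le hβ1
  refine (hmain ⌈β ^ θ⌉₊ β δ hβ1 ω hω (β ^ (2 * ε - 1))).trans ?_
  set n : ℕ := 2 * ⌈β ^ θ⌉₊ + 1 with hn
  set Λ := AxialGauge.boxEdges 4 n with hΛ
  -- the box side in terms of β^θ
  have hX1 : 1 ≤ β ^ θ := Real.one_le_rpow hβ1 hθ.le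
  have hc' : (⌈β ^ θ⌉₊ : ℝ) < β ^ θ + 1 := Nat.ceil_lt_add_one (by linarith)
  have hnR : (n : ℝ) ≤ 5 * β ^ θ := by rw [hn]; push_cast; nlinarith
  have e4 : β ^ (4 * θ) = (β ^ θ) ^ 4 := by
    rw [← Real.rpow_natCast (β ^ θ) 4, ← Real.rpow_mul hβ0.le]; norm_num; ring_nf
  have hn4 : (n : ℝ) ^ 4 ≤ 625 * β ^ (4 * θ) := by
    rw [e4]
    calc (n : ℝ) ^ 4 ≤ (5 * β ^ θ) ^ 4 := pow_le_pow_left₀ (by positivity) hnR 4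
      _ = 625 * (β ^ θ) ^ 4 := by ring
  have hΛR : (#Λ : ℝ) ≤ 2500 * β ^ (4 * θ) := by
    have h := card_boxEdges_four_le n
    calc (#Λ : ℝ) ≤ ((4 * n ^ 4 : ℕ) : ℝ) := by rw [hΛ]; exact_mod_cast h
      _ = 4 * (n : ℝ) ^ 4 := by push_cast; ring
      _ ≤ 4 * (625 * β ^ (4 * θ)) := by linarith
      _ = 2500 * β ^ (4 * θ) := by ring
  have hΛ'R : (#(plaquettesTouching Λ) : ℝ) ≤ 75000 * β ^ (4 * θ) := by
    have h := card_plaquettesTouching_boxEdges_le n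
    calc (#(plaquettesTouching Λ) : ℝ) ≤ ((120 * n ^ 4 : ℕ) : ℝ) := by rw [hΛ]; exact_mod_cast h
      _ = 120 * (n : ℝ) ^ 4 := by push_cast; ring
      _ ≤ 120 * (625 * β ^ (4 * θ)) := by linarith
      _ = 75000 * β ^ (4 * θ) := by ring
  -- the base c (√β)^D as an exponential
  set A : ℝ := c * Real.sqrt β ^ D with hA
  have hA0 : 0 < A := by positivity
  have hlogA : Real.log A ≤ |Real.log c| + D / 2 * Real.log β := by
    rw [hA, Real.log_mul hc.ne' (by positivity), Real.log_pow, Real.log_sqrt hβ0.le]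
    have := le_abs_self (Real.log c)
    have : (D : ℝ) * (Real.log β / 2) = D / 2 * Real.log β := by ring
    linarith
  have hpow : A ^ #Λ = Real.exp (#Λ * Real.log A) := by
    rw [Real.exp_nat_mul, Real.exp_log hA0]
  have hs : β * β ^ (2 * ε - 1) = β ^ (2 * ε) := by
    rw [show β * β ^ (2 * ε - 1) = β ^ (1 : ℝ) * β ^ (2 * ε - 1) by rw [Real.rpow_one],
      ← Real.rpow_add hβ0]; congr 1; ring
  rw [hpow, ← Real.exp_add, ← Real.exp_add, hs]
  refine Real.exp_le_exp.2 ?_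
  have hlog0 : 0 ≤ Real.log β := Real.log_nonneg hβ1
  have hY0 : 0 ≤ β ^ (4 * θ) := Real.rpow_nonneg hβ0.le _
  have hZ0 : 0 ≤ β ^ (2 * δ) := Real.rpow_nonneg hβ0.le _
  have hN0 : (0 : ℝ) ≤ N := Nat.cast_nonneg _
  -- the middle term: (2Nβ^{2δ} + 16N) #Λ' ≤ 18N·75000 β^{4θ+2δ}
  have e6 : β ^ (2 * δ) * β ^ (4 * θ) = β ^ (4 * ((2 * θ + δ) / 2)) := by
    rw [← Real.rpow_add hβ0]; congr 1; ring
  have h4θ : β ^ (4 * θ) ≤ β ^ (4 * ((2 * θ + δ) / 2)) := Real.rpow_le_rpow_of_exponent_le hβ1 (by linarith)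
  have hZ1 : 1 ≤ β ^ (2 * δ) := Real.one_le_rpow hβ1 (by linarith)
  have hmid : (2 * N * β ^ (2 * δ) + 16 * N) * #(plaquettesTouching Λ) ≤
      18 * N * 75000 * β ^ (4 * ((2 * θ + δ) / 2)) := by
    rw [← e6]
    have h1 : (2 * N * β ^ (2 * δ) + 16 * N) ≤ 18 * N * β ^ (2 * δ) := by nlinarith
    have h2 : (2 * N * β ^ (2 * δ) + 16 * N) * #(plaquettesTouching Λ) ≤
        (18 * N * β ^ (2 * δ)) * (75000 * β ^ (4 * θ)) :=
      mul_le_mul h1 hΛ'R (Nat.cast_nonneg _) (by positivity)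
    linarith
  -- the last term
  have h3 : (#Λ : ℝ) * Real.log A ≤ 2500 * β ^ (4 * ((2 * θ + δ) / 2)) * (|Real.log c| + D / 2 * Real.log β) := by
    calc (#Λ : ℝ) * Real.log A ≤ #Λ * (|Real.log c| + D / 2 * Real.log β) :=
          mul_le_mul_of_nonneg_left hlogA (Nat.cast_nonneg _)
      _ ≤ 2500 * β ^ (4 * θ) * (|Real.log c| + D / 2 * Real.log β) :=
          mul_le_mul_of_nonneg_right hΛR (by positivity)
      _ ≤ 2500 * β ^ (4 * ((2 * θ + δ) / 2)) * (|Real.log c| + D / 2 * Real.log β) :=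
          mul_le_mul_of_nonneg_right (mul_le_mul_of_nonneg_left h4θ (by norm_num)) (by positivity)
  have h4 := hasy β hβ
  nlinarith [h3, h4, hmid, abs_nonneg (Real.log c), Real.rpow_nonneg hβ0.le (4 * ((2 * θ + δ) / 2))]

include hρu hρc in
/-- **The small-field event under the kernel, flat rate**: for `0 < θ`, `0 ≤ δ`, `2θ + δ < ε`, eventually in `β`, for every crude-good `ω`,
`boxKernelG ρ β H ω (coldGoodSetG ρ H β ε)ᶜ ≤ e^{−β^ε}` (`H = ⌈β^θ⌉`).  Supersedes `boxKernelG_real_coldGoodSetG_compl_le` (`3θ + δ < ε`). -/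
theorem boxKernelG_real_coldGoodSetG_compl_le_flat {θ δ ε : ℝ} (hθ : 0 < θ) (hδ : 0 ≤ δ) (hε : 2 * θ + δ < ε) :
    ∃ β₀ : ℝ, ∀ β : ℝ, β₀ ≤ β → ∀ ω : LGConfig 4 G, CrudeGoodG ρ β δ ⌈β ^ θ⌉₊ ω →
      (boxKernelG ρ β ⌈β ^ θ⌉₊ ω).real (coldGoodSetG ρ ⌈β ^ θ⌉₊ β ε)ᶜ ≤ Real.exp (-(β ^ ε)) := by
  obtain ⟨β₀, hβ₀⟩ := boxKernelG_largeField_rarity_crudeGood_flat ρ hρu hρc hθ hδ hε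
  refine ⟨β₀, fun β hβ ω hω => ?_⟩
  rw [coldGoodSetG, compl_compl]
  exact hβ₀ β hβ ω hω

end Summit.QuantumFields.YangMills.Theorems.ColdBoxAllGroups

end
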